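import Mathlib
import Literature.MathematicalPhysics.StatisticalMechanics.LennardJonesClusters
import Summits.AtomisticToContinuum.Crystallization.Theorems.ChargedEnergyGap.Negative.Periodisation
import Summits.AtomisticToContinuum.Crystallization.Theorems.ChargedEnergyGap.Negative.BlocksBound
import Summits.AtomisticToContinuum.Crystallization.Theorems.PalmUnimodularRigidityUnimodularEnergyLowerBoundHardCore
import HarnessLib

/-!
# The cluster inequality: a ball of a hard-core configuration has energy at least `n · e*`

Support file for item `stmt-AtomisticToContinuum-9229` (`UnimodularEnergyLowerBound`, route
`PalmUnimodularRigidity`).  The deterministic energy input of the mass-transport proof of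
`e_uni ≥ e*`:

* `eStar_nonpos`: `e* ≤ 0` (one particle, periodised);
* `sum_sum_ofReal_neg_lennardJones_le`: for every finite set `T ⊂ ℝ³`,
  `Σ_{y,z ∈ T} V_LJ(‖z-y‖)⁻ ≤ Σ_{y,z ∈ T} V_LJ(‖z-y‖)⁺ + 2·#T·(-e*)` — i.e. `2·E_LJ(T) ≥ #T · e*`, the
  tree's periodisation bound `card_mul_eStar_le_interactionEnergy` (with item 0714
  `bddBelow_energyPerParticle_lennardJones`) written without subtraction in `ℝ≥0∞`;
* `setLIntegral_ball_cluster_le`: the same inequality dressed as integrals against the counting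
  measure `μ = count|S` of a separated set over the points of a ball `B(v,R)`: the infinite "outside"
  parts `∫_{B(v,R)ᶜ} V⁻(‖z-y‖) dμ(z)` appear identically on both sides, so only the finite cluster
  `S ∩ B(v,R)` matters;
* re-rooting identities (`lintegral_map_sub`, `setLIntegral_compl_ball_map_sub`) evaluating such
  functionals at the configuration re-rooted at one of its points.

All `[folklore]`.
-/

noncomputable section

namespace Summit.AtomisticToContinuum.Crystallization.Theorems.UnimodularEnergy

open MeasureTheory Metric Set Filter
open scoped ENNReal Topology
open Literature.MathematicalPhysics.StatisticalMechanics
open Summit.AtomisticToContinuum.Crystallization.Theorems.ChargedEnergyGapNegative (E3 eStar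
  card_mul_eStar_le_interactionEnergy bddBelow_energyPerParticle_lennardJones)

/-! ### The finite inequality -/

section Finite

/-- `e* ≤ 0`: a single particle, periodised, has energy per particle `≤ 0`. [folklore] -/
theorem eStar_nonpos : eStar ≤ 0 := by
  have h := card_mul_eStar_le_interactionEnergy bddBelow_energyPerParticle_lennardJones
    (N := 1) (x := fun _ => (0 : E3)) (fun i j _ => Subsingleton.elim i j)
  rw [interactionEnergy_of_subsingleton] at h
  simpa using h

/-- `ENNReal.ofReal` only sees the positive part. [folklore] -/
theorem ofReal_max_zero (a : ℝ) : ENNReal.ofReal (max a 0) = ENNReal.ofReal a := by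
  rcases le_total a 0 with h | h
  · rw [max_eq_right h, ENNReal.ofReal_zero, ENNReal.ofReal_of_nonpos h]
  · rw [max_eq_left h]

/-- **`2 E_LJ(T) ≥ #T · e*` for every finite set `T ⊂ ℝ³`** (double-sum form): the sum over ORDERED
pairs `(y, z) ∈ T²` of `V_LJ(‖z - y‖)` (diagonal terms vanish, `V_LJ(0) = 0`) is at least
`2 · #T · e*`. [folklore] -/
theorem two_mul_card_mul_eStar_le_sum_sum (T : Finset E3) :
    2 * (T.card : ℝ) * eStar ≤ ∑ y ∈ T, ∑ z ∈ T, lennardJones ‖z - y‖ := by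
  classical
  set e : {z // z ∈ T} ≃ Fin T.card := T.equivFin with he
  set x : Fin T.card → E3 := fun i => (e.symm i : E3) with hx
  have hxinj : Function.Injective x := fun i j h =>
    e.symm.injective (Subtype.ext h)
  have h1 := card_mul_eStar_le_interactionEnergy bddBelow_energyPerParticle_lennardJones hxinj
  have h2 := two_mul_interactionEnergy_eq_sum_sum lennardJones lennardJones_zero x
  have h3 : ∑ i, ∑ k, lennardJones (dist (x i) (x k)) = ∑ y ∈ T, ∑ z ∈ T, lennardJones ‖z - y‖ := by
    have inner : ∀ y : E3, ∑ k, lennardJones (dist y (x k)) = ∑ z ∈ T, lennardJones ‖z - y‖ := by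
      intro y
      rw [← Finset.sum_coe_sort T (fun z => lennardJones ‖z - y‖), ← Equiv.sum_comp e.symm]
      refine Finset.sum_congr rfl fun k _ => ?_
      rw [dist_comm, dist_eq_norm]
    simp_rw [inner]
    rw [← Finset.sum_coe_sort T (fun y => ∑ z ∈ T, lennardJones ‖z - y‖), ← Equiv.sum_comp e.symm]
  linarith [h1, h2, h3]

/-- **The cluster inequality, `ℝ≥0∞` form.** For every finite `T ⊂ ℝ³`:
`Σ_{y,z ∈ T} V_LJ(‖z-y‖)⁻ ≤ Σ_{y,z ∈ T} V_LJ(‖z-y‖)⁺ + 2·#T·(-e*)⁺`. [folklore] -/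
theorem sum_sum_ofReal_neg_lennardJones_le (T : Finset E3) :
    ∑ y ∈ T, ∑ z ∈ T, ENNReal.ofReal (-lennardJones ‖z - y‖) ≤
      ∑ y ∈ T, (∑ z ∈ T, ENNReal.ofReal (lennardJones ‖z - y‖) + 2 * ENNReal.ofReal (-eStar)) := by
  have key := two_mul_card_mul_eStar_le_sum_sum T
  -- rewrite everything as `ofReal` of sums of non-negative reals
  have hL : ∑ y ∈ T, ∑ z ∈ T, ENNReal.ofReal (-lennardJones ‖z - y‖) =
      ENNReal.ofReal (∑ y ∈ T, ∑ z ∈ T, max (-lennardJones ‖z - y‖) 0) := by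
    rw [ENNReal.ofReal_sum_of_nonneg fun y _ => Finset.sum_nonneg fun z _ => le_max_right _ _]
    refine Finset.sum_congr rfl fun y _ => ?_
    rw [ENNReal.ofReal_sum_of_nonneg fun z _ => le_max_right _ _]
    exact Finset.sum_congr rfl fun z _ => (ofReal_max_zero _).symm
  have hR : ∑ y ∈ T, (∑ z ∈ T, ENNReal.ofReal (lennardJones ‖z - y‖) + 2 * ENNReal.ofReal (-eStar)) =
      ENNReal.ofReal (∑ y ∈ T, (∑ z ∈ T, max (lennardJones ‖z - y‖) 0 + 2 * max (-eStar) 0)) := by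
    rw [ENNReal.ofReal_sum_of_nonneg fun y _ => add_nonneg
      (Finset.sum_nonneg fun z _ => le_max_right _ _) (by positivity)]
    refine Finset.sum_congr rfl fun y _ => ?_
    rw [ENNReal.ofReal_add (Finset.sum_nonneg fun z _ => le_max_right _ _) (by positivity),
      ENNReal.ofReal_sum_of_nonneg fun z _ => le_max_right _ _,
      ENNReal.ofReal_mul zero_le_two, ofReal_max_zero, ENNReal.ofReal_ofNat]
    congr 1
    exact Finset.sum_congr rfl fun z _ => (ofReal_max_zero _).symm
  rw [hL, hR]
  apply ENNReal.ofReal_le_ofReal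
  -- the real inequality
  have hsplit : ∀ a : ℝ, max (-a) 0 = max a 0 - a := fun a => by
    rcases le_total a 0 with h | h
    · rw [max_eq_left (neg_nonneg.2 h), max_eq_right h]; ring
    · rw [max_eq_right (neg_nonpos.2 h), max_eq_left h]; ring
  simp_rw [hsplit, Finset.sum_sub_distrib, Finset.sum_add_distrib, Finset.sum_const, nsmul_eq_mul]
  have hM : 0 ≤ (T.card : ℝ) * max eStar 0 := mul_nonneg T.card.cast_nonneg (le_max_right _ _)
  nlinarith [key, hM]

end Finite

/-! ### Dressing: integrals against the counting measure over the points of a ball -/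

section Dressing

variable {δ : ℝ} {S : Set E3}

/-- Integration over the points of `S` in a ball is a finite sum. [folklore] -/
theorem setLIntegral_ball_count_restrict (hδ : 0 < δ)
    (hsep : ∀ x ∈ S, ∀ y ∈ S, x ≠ y → δ ≤ dist x y) (v : E3) (R : ℝ) (f : E3 → ℝ≥0∞) :
    ∫⁻ y in ball v R, f y ∂((Measure.count : Measure E3).restrict S) =
      ∑ y ∈ (finite_ball_inter hδ hsep v R).toFinset, f y := by
  conv_lhs => rw [Measure.restrict_restrict measurableSet_ball,
    ← (finite_ball_inter hδ hsep v R).coe_toFinset]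
  rw [lintegral_finset]
  simp

/-- **The cluster inequality for a ball of a hard-core configuration.** For `μ = count|S`, `S`
separated, and any ball `B = B(v,R)`:
`∫_B ∫ V⁻(‖z-y‖) dμ(z) dμ(y) ≤ ∫_B [∫ V⁺(‖z-y‖) dμ(z) + 2(-e*)⁺ + ∫_{Bᶜ} V⁻(‖z-y‖) dμ(z)] dμ(y)`:
splitting the inner integral on the left into `B` and `Bᶜ`, the `Bᶜ` parts match and the `B`
parts are the finite inequality `sum_sum_ofReal_neg_lennardJones_le` for the cluster `S ∩ B`.
[folklore] -/
theorem setLIntegral_ball_cluster_le (hδ : 0 < δ)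
    (hsep : ∀ x ∈ S, ∀ y ∈ S, x ≠ y → δ ≤ dist x y) (v : E3) (R : ℝ) :
    ∫⁻ y in ball v R, (∫⁻ z, ENNReal.ofReal (-lennardJones ‖z - y‖)
        ∂((Measure.count : Measure E3).restrict S)) ∂((Measure.count : Measure E3).restrict S) ≤
      ∫⁻ y in ball v R,
        (∫⁻ z, ENNReal.ofReal (lennardJones ‖z - y‖) ∂((Measure.count : Measure E3).restrict S) +
          2 * ENNReal.ofReal (-eStar) +
          ∫⁻ z in (ball v R)ᶜ, ENNReal.ofReal (-lennardJones ‖z - y‖)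
            ∂((Measure.count : Measure E3).restrict S))
        ∂((Measure.count : Measure E3).restrict S) := by
  set μ : Measure E3 := (Measure.count : Measure E3).restrict S with hμ
  set T : Finset E3 := (finite_ball_inter hδ hsep v R).toFinset with hT
  rw [setLIntegral_ball_count_restrict hδ hsep v R, setLIntegral_ball_count_restrict hδ hsep v R]
  -- split the inner integrals on the left at the ball
  have hsplitL : ∀ y : E3, ∫⁻ z, ENNReal.ofReal (-lennardJones ‖z - y‖) ∂μ =
      ∑ z ∈ T, ENNReal.ofReal (-lennardJones ‖z - y‖) +
        ∫⁻ z in (ball v R)ᶜ, ENNReal.ofReal (-lennardJones ‖z - y‖) ∂μ := fun y => by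
    rw [← lintegral_add_compl _ measurableSet_ball, setLIntegral_ball_count_restrict hδ hsep v R]
  -- drop the outside positive parts on the right
  have hdropR : ∀ y : E3, ∑ z ∈ T, ENNReal.ofReal (lennardJones ‖z - y‖) ≤
      ∫⁻ z, ENNReal.ofReal (lennardJones ‖z - y‖) ∂μ := fun y => by
    rw [← lintegral_add_compl _ measurableSet_ball, setLIntegral_ball_count_restrict hδ hsep v R]
    exact le_self_add
  calc ∑ y ∈ T, ∫⁻ z, ENNReal.ofReal (-lennardJones ‖z - y‖) ∂μ
      = ∑ y ∈ T, ∑ z ∈ T, ENNReal.ofReal (-lennardJones ‖z - y‖) +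
          ∑ y ∈ T, ∫⁻ z in (ball v R)ᶜ, ENNReal.ofReal (-lennardJones ‖z - y‖) ∂μ := by
        rw [← Finset.sum_add_distrib]
        exact Finset.sum_congr rfl fun y _ => hsplitL y
    _ ≤ ∑ y ∈ T, (∑ z ∈ T, ENNReal.ofReal (lennardJones ‖z - y‖) + 2 * ENNReal.ofReal (-eStar)) +
          ∑ y ∈ T, ∫⁻ z in (ball v R)ᶜ, ENNReal.ofReal (-lennardJones ‖z - y‖) ∂μ :=
        add_le_add (sum_sum_ofReal_neg_lennardJones_le T) le_rfl
    _ ≤ ∑ y ∈ T, (∫⁻ z, ENNReal.ofReal (lennardJones ‖z - y‖) ∂μ + 2 * ENNReal.ofReal (-eStar) +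
          ∫⁻ z in (ball v R)ᶜ, ENNReal.ofReal (-lennardJones ‖z - y‖) ∂μ) := by
        rw [← Finset.sum_add_distrib]
        exact Finset.sum_le_sum fun y _ =>
          add_le_add (add_le_add (hdropR y) le_rfl) le_rfl

end Dressing

/-! ### Re-rooting identities -/

section Reroot

/-- A functional `∫ f dν` at the re-rooted configuration `θ_y μ = μ.map (· - y)` is
`∫ f(z - y) dμ(z)`. [folklore] -/
theorem lintegral_map_sub (μ : Measure E3) (y : E3) {f : E3 → ℝ≥0∞} (hf : Measurable f) :
    ∫⁻ z, f z ∂(μ.map fun z => z - y) = ∫⁻ z, f (z - y) ∂μ :=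
  lintegral_map hf (measurable_sub_const y)

/-- The "outside a ball" functional at the re-rooted configuration:
`∫_{B(w,R)ᶜ} f d(θ_y μ) = ∫_{B(w + y, R)ᶜ} f(z - y) dμ(z)`. [folklore] -/
theorem setLIntegral_compl_ball_map_sub (μ : Measure E3) (y w : E3) (R : ℝ) {f : E3 → ℝ≥0∞}
    (hf : Measurable f) :
    ∫⁻ z in (ball w R)ᶜ, f z ∂(μ.map fun z => z - y) = ∫⁻ z in (ball (w + y) R)ᶜ, f (z - y) ∂μ := by
  have hpre : (fun z : E3 => z - y) ⁻¹' (ball w R)ᶜ = (ball (w + y) R)ᶜ := by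
    ext z
    rw [mem_preimage, mem_compl_iff, mem_compl_iff, mem_ball, mem_ball,
      ← dist_sub_right z (w + y) y, add_sub_cancel_right]
  rw [setLIntegral_map measurableSet_ball.compl hf (measurable_sub_const y), hpre]

end Reroot

end Summit.AtomisticToContinuum.Crystallization.Theorems.UnimodularEnergy

end
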